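import Literature.MathematicalPhysics.QuantumManyBody.LangevinGenerator
import Literature.MathematicalPhysics.QuantumManyBody.PeriodicConfigFourier
import Literature.MathematicalPhysics.QuantumManyBody.PeriodicBoseGasMomentumSector
import Literature.MathematicalPhysics.QuantumManyBody.BoseGasProductState
import Mathlib.Analysis.InnerProductSpace.Calculus
import HarnessLib

/-!
# The coordinate Laplacian of complex `N`-body functions on the torus: symmetry, Green's formula,
# du Bois-Reymond

Topic `Literature/MathematicalPhysics/QuantumManyBody`; complex-valued companion of the real-valued
calculus of `WeightedCorrector.lean` / `LangevinGenerator.lean` (`pderiv`, `configLaplacian`,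
`integral_cellN_pderiv_eq_zero`) for wave functions `Ψ : (ℝ³)^N → ℂ` of the periodic Bose gas
(`PeriodicBoseGas.lean`: `Config N`, `cellN N L = [0,L)^{3N}`, `PeriodicTrialState`;
`PeriodicConfigFourier.lean`: `IsTorusPeriodic`). Written for the Euler–Lagrange (eigenvalue)
equation `-ΔΨ + VΨ = E₀Ψ` of an exact minimiser of the periodic `N`-body energy, whose derivation
tests the first variation (`PeriodicEnergyFirstVariation.lean`) against the residual and integrates
by parts once on the torus.

Notation (local): `𝐞[i, a] = Pi.single i (EuclideanSpace.single a 1)` is the unit vector of particle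
`i`, axis `a`; `∂_{i,a}Ψ(X) = DΨ(X) 𝐞[i,a]` (`fderiv`), and the **coordinate Laplacian** is written out
as `ΔΨ(X) = ∑ᵢ ∑ₐ D(Y ↦ DΨ(Y)𝐞[i,a])(X) 𝐞[i,a]` (no new definition is introduced; `Config N` is the
sup-normed product, so Mathlib's inner-product `Laplacian` does not apply verbatim).

* `contDiff_fderiv_apply_single`, `contDiff_configLaplacian_complex` — `Ψ ∈ C^{n+1} ⇒ ∂Ψ ∈ Cⁿ`,
  `Ψ ∈ C^{n+2} ⇒ ΔΨ ∈ Cⁿ`;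
* `IsTorusPeriodic.fderiv_apply`, `IsTorusPeriodic.configLaplacian_complex` — derivatives and the
  Laplacian of `Lℤ³`-periodic functions are periodic;
* `fderiv_comp_relabel_apply(_single)`, `configLaplacian_complex_comp_perm`,
  `configLaplacian_complex_symm` — relabelling the particles (`relabelCLM σ : X ↦ X ∘ σ` of
  `BoseGasProductState.lean`) commutes with `Δ`; the Laplacian of a Bose-symmetric `C²` function is
  Bose-symmetric;
* `integral_cellN_inner_fderiv_eq_neg` — **integration by parts on the `N`-particle torus** in
  real-inner-product form, `∫_{cell} ⟪u, ∂_{i,a}η⟫_ℝ = -∫_{cell} ⟪∂_{i,a}u, η⟫_ℝ` for `C¹` periodic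
  `u, η` (`⟪z, w⟫_ℝ = Re(z̄w)` is Mathlib's real inner product on `ℂ`), and **Green's formula**
  `integral_cellN_sum_inner_fderiv_eq`: `∫ ∑_{i,a} ⟪∂_{i,a}Ψ, ∂_{i,a}η⟫_ℝ = -∫ ⟪ΔΨ, η⟫_ℝ`
  (`Ψ ∈ C²`, `η ∈ C¹`, both periodic);
* **du Bois-Reymond on the torus** `IsTorusPeriodic.eq_zero_of_lintegral_normSq_eq_zero`: a continuous
  periodic `r` with `∫_{cell} |r|² = 0` vanishes identically (Lebesgue measure charges the open box,
  `lintegral_cellN_pos`; the closed box by continuity along the segment to the centre; all of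
  `(ℝ³)^N` by lattice reduction `exists_fromUnitTorusN_toUnitTorusN_eq`).

## References
* [BakryGentilLedoux2014] D. Bakry, I. Gentil, M. Ledoux, *Analysis and Geometry of Markov Diffusion
  Operators* (2014), §1.11.3 (integration by parts on a torus, behind (1.11.9)) — via
  `integral_cellN_pderiv_eq_zero`.
* [LSSY2005] E. H. Lieb, R. Seiringer, J. P. Solovej, J. Yngvason, *The Mathematics of the Bose Gas and
  its Condensation* (2005), Ch. 2 (2.1) (the `N`-body Hamiltonian `-∑Δᵢ + ∑ v`, units `ħ = 2m = 1`).
-/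

noncomputable section

open MeasureTheory Filter Set
open scoped ENNReal NNReal Topology InnerProductSpace

namespace Literature.MathematicalPhysics.QuantumManyBody.BoseGas

variable {N : ℕ} {L : ℝ}

/-- The coordinate unit vector `e_{i,a}` of `(ℝ³)^N` (particle `i`, axis `a`), local notation. -/
local notation3 "𝐞[" i ", " a "]" => (Pi.single i (EuclideanSpace.single a (1 : ℝ)) : Config _)

/-! ### Calculus of complex functions on `(ℝ³)^N`: partial derivatives and the coordinate Laplacian -/

section Calculus

variable {f : Config N → ℂ}

/-- For `f ∈ C^{n+1}`, the partial derivative `X ↦ ∂_{i,a} f(X) = Df(X) e_{i,a}` is `Cⁿ`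
(complex-valued version of `contDiff_pderiv`). [folklore] -/
theorem contDiff_fderiv_apply_single {n : WithTop ℕ∞} (hf : ContDiff ℝ (n + 1) f) (i : Fin N)
    (a : Fin 3) : ContDiff ℝ n (fun X => fderiv ℝ f X 𝐞[i, a]) :=
  (hf.fderiv_right le_rfl).clm_apply contDiff_const

/-- For `f ∈ C^{n+2}`, the coordinate Laplacian `Δf = ∑ᵢ ∑ₐ ∂_{i,a}∂_{i,a} f` is `Cⁿ`. [folklore] -/
theorem contDiff_configLaplacian_complex {n : WithTop ℕ∞} (hf : ContDiff ℝ (n + 1 + 1) f) :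
    ContDiff ℝ n (fun X => ∑ i : Fin N, ∑ a : Fin 3,
      fderiv ℝ (fun Y => fderiv ℝ f Y 𝐞[i, a]) X 𝐞[i, a]) :=
  ContDiff.sum fun i _ => ContDiff.sum fun a _ =>
    contDiff_fderiv_apply_single (contDiff_fderiv_apply_single hf i a) i a

/-- **Derivatives of periodic functions are periodic**: if `f` is `Lℤ³`-periodic in every particle
then so is `X ↦ Df(X) w` (differentiate `f(· + L e_{j,l}) = f`). [folklore] -/
theorem IsTorusPeriodic.fderiv_apply (h : IsTorusPeriodic L f) (w : Config N) :
    IsTorusPeriodic L (fun X => fderiv ℝ f X w) := by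
  intro X j l
  have hf : (fun Y => f (Y + Pi.single j (EuclideanSpace.single l L))) = f := funext fun Y => h Y j l
  show fderiv ℝ f (X + Pi.single j (EuclideanSpace.single l L)) w = fderiv ℝ f X w
  rw [← fderiv_comp_add_right, hf]

/-- The coordinate Laplacian of a periodic function is periodic. [folklore] -/
theorem IsTorusPeriodic.configLaplacian_complex (h : IsTorusPeriodic L f) :
    IsTorusPeriodic L (fun X => ∑ i : Fin N, ∑ a : Fin 3,
      fderiv ℝ (fun Y => fderiv ℝ f Y 𝐞[i, a]) X 𝐞[i, a]) := by
  intro X j l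
  simp only
  refine Finset.sum_congr rfl fun i _ => Finset.sum_congr rfl fun a _ => ?_
  exact ((h.fderiv_apply 𝐞[i, a]).fderiv_apply 𝐞[i, a]) X j l

/-- Chain rule for relabelling the particles: `D(f ∘ (· ∘ σ))(X) w = Df(X ∘ σ) (w ∘ σ)`. [folklore] -/
theorem fderiv_comp_relabel_apply (σ : Equiv.Perm (Fin N)) (hf : Differentiable ℝ f) (X w : Config N) :
    fderiv ℝ (fun Y => f (Y ∘ σ)) X w = fderiv ℝ f (X ∘ σ) (w ∘ σ) := by
  have hd : fderiv ℝ (fun Y => f (Y ∘ σ)) X = (fderiv ℝ f (X ∘ σ)).comp (relabelCLM σ) := by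
    have h1 : HasFDerivAt f (fderiv ℝ f (X ∘ σ)) (relabelCLM σ X) := (hf _).hasFDerivAt
    exact (h1.comp X (relabelCLM σ).hasFDerivAt).fderiv
  rw [hd]
  rfl

/-- Relabelling and partial derivatives: `∂_{i,a}(f ∘ (· ∘ σ))(X) = (∂_{σ⁻¹ i, a} f)(X ∘ σ)`.
[folklore] -/
theorem fderiv_comp_relabel_apply_single (σ : Equiv.Perm (Fin N)) (hf : Differentiable ℝ f)
    (X : Config N) (i : Fin N) (a : Fin 3) :
    fderiv ℝ (fun Y => f (Y ∘ σ)) X 𝐞[i, a] = fderiv ℝ f (X ∘ σ) 𝐞[σ.symm i, a] := by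
  rw [fderiv_comp_relabel_apply σ hf, single_comp_perm]

/-- **The coordinate Laplacian commutes with relabelling**: `Δ(f ∘ (· ∘ σ))(X) = (Δf)(X ∘ σ)` for
`f ∈ C²`. [folklore] -/
theorem configLaplacian_complex_comp_perm (σ : Equiv.Perm (Fin N)) (hf : ContDiff ℝ 2 f)
    (X : Config N) :
    (∑ i : Fin N, ∑ a : Fin 3,
      fderiv ℝ (fun Y => fderiv ℝ (fun Z => f (Z ∘ σ)) Y 𝐞[i, a]) X 𝐞[i, a]) =
    ∑ i : Fin N, ∑ a : Fin 3,
      fderiv ℝ (fun Y => fderiv ℝ f Y 𝐞[i, a]) (X ∘ σ) 𝐞[i, a] := by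
  have hfd : Differentiable ℝ f := hf.differentiable two_ne_zero
  have hgd : ∀ (j : Fin N) (b : Fin 3), Differentiable ℝ (fun Y => fderiv ℝ f Y 𝐞[j, b]) :=
    fun j b => (contDiff_fderiv_apply_single (n := 1) hf j b).differentiable one_ne_zero
  have hinner : ∀ (i : Fin N) (a : Fin 3),
      (fun Y => fderiv ℝ (fun Z => f (Z ∘ σ)) Y 𝐞[i, a]) =
        fun Y => (fun Z => fderiv ℝ f Z 𝐞[σ.symm i, a]) (Y ∘ σ) := fun i a =>
    funext fun Y => fderiv_comp_relabel_apply_single σ hfd Y i a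
  simp_rw [hinner]
  have hout : ∀ (i : Fin N) (a : Fin 3),
      fderiv ℝ (fun Y => (fun Z => fderiv ℝ f Z 𝐞[σ.symm i, a]) (Y ∘ σ)) X 𝐞[i, a] =
        fderiv ℝ (fun Z => fderiv ℝ f Z 𝐞[σ.symm i, a]) (X ∘ σ) 𝐞[σ.symm i, a] := fun i a =>
    fderiv_comp_relabel_apply_single σ (hgd _ _) X i a
  simp_rw [hout]
  exact Fintype.sum_equiv σ.symm _ _ fun i => rfl

/-- The coordinate Laplacian of a Bose-symmetric `C²` function is Bose-symmetric. [folklore] -/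
theorem configLaplacian_complex_symm (hf : ContDiff ℝ 2 f)
    (hsymm : ∀ (σ : Equiv.Perm (Fin N)) (X : Config N), f (X ∘ σ) = f X)
    (σ : Equiv.Perm (Fin N)) (X : Config N) :
    (∑ i : Fin N, ∑ a : Fin 3, fderiv ℝ (fun Y => fderiv ℝ f Y 𝐞[i, a]) (X ∘ σ) 𝐞[i, a]) =
      ∑ i : Fin N, ∑ a : Fin 3, fderiv ℝ (fun Y => fderiv ℝ f Y 𝐞[i, a]) X 𝐞[i, a] := by
  rw [← configLaplacian_complex_comp_perm σ hf X]
  have h : (fun Z : Config N => f (Z ∘ σ)) = f := funext fun Z => hsymm σ Z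
  simp_rw [h]

/-- **Integration by parts on the `N`-particle torus, inner-product form**: for `C¹` functions
`u, η : (ℝ³)^N → ℂ` that are `Lℤ³`-periodic in every particle,
`∫_{[0,L)^{3N}} ⟪u, ∂_{i,a}η⟫_ℝ = -∫_{[0,L)^{3N}} ⟪∂_{i,a}u, η⟫_ℝ` (the real part of the `L²` pairing;
from `integral_cellN_pderiv_eq_zero` applied to `⟪u, η⟫_ℝ`). [folklore] -/
theorem integral_cellN_inner_fderiv_eq_neg (hL : 0 < L) {u η : Config N → ℂ} (hu : ContDiff ℝ 1 u)
    (hη : ContDiff ℝ 1 η) (hup : IsTorusPeriodic L u) (hηp : IsTorusPeriodic L η) (i : Fin N)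
    (a : Fin 3) :
    ∫ X in cellN N L, ⟪u X, fderiv ℝ η X 𝐞[i, a]⟫_ℝ =
      -∫ X in cellN N L, ⟪fderiv ℝ u X 𝐞[i, a], η X⟫_ℝ := by
  set G : Config N → ℝ := fun X => ⟪u X, η X⟫_ℝ with hG
  have hGc : ContDiff ℝ 1 G := hu.inner ℝ hη
  have hGper : IsLatticePeriodic L G := fun X j l => by simp only [hG, hup X j l, hηp X j l]
  have h0 := integral_cellN_pderiv_eq_zero hL hGc hGper i a
  have hderiv : ∀ X, pderiv i a G X =
      ⟪u X, fderiv ℝ η X 𝐞[i, a]⟫_ℝ + ⟪fderiv ℝ u X 𝐞[i, a], η X⟫_ℝ := fun X =>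
    fderiv_inner_apply ℝ (hu.differentiable one_ne_zero X) (hη.differentiable one_ne_zero X) _
  simp_rw [hderiv] at h0
  have h1 : IntegrableOn (fun X => ⟪u X, fderiv ℝ η X 𝐞[i, a]⟫_ℝ) (cellN N L) volume :=
    integrableOn_cellN (hu.continuous.inner (𝕜 := ℝ)
      ((hη.continuous_fderiv one_ne_zero).clm_apply continuous_const)) L
  have h2 : IntegrableOn (fun X => ⟪fderiv ℝ u X 𝐞[i, a], η X⟫_ℝ) (cellN N L) volume :=
    integrableOn_cellN (((hu.continuous_fderiv one_ne_zero).clm_apply continuous_const).inner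
      (𝕜 := ℝ) hη.continuous) L
  rw [integral_add h1 h2] at h0
  linarith

/-- **Green's formula for the coordinate Laplacian on the torus** (real part of
`⟨∇ψ, ∇η⟩ = ⟨-Δψ, η⟩`): for `ψ ∈ C²` and `η ∈ C¹`, both `Lℤ³`-periodic in every particle,
`∫ ∑_{i,a} ⟪∂_{i,a}ψ, ∂_{i,a}η⟫_ℝ = -∫ ⟪Δψ, η⟫_ℝ`. [folklore] -/
theorem integral_cellN_sum_inner_fderiv_eq (hL : 0 < L) {ψ η : Config N → ℂ} (hψ : ContDiff ℝ 2 ψ)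
    (hη : ContDiff ℝ 1 η) (hψp : IsTorusPeriodic L ψ) (hηp : IsTorusPeriodic L η) :
    ∫ X in cellN N L, ∑ i : Fin N, ∑ a : Fin 3, ⟪fderiv ℝ ψ X 𝐞[i, a], fderiv ℝ η X 𝐞[i, a]⟫_ℝ =
      -∫ X in cellN N L, ⟪∑ i : Fin N, ∑ a : Fin 3,
          fderiv ℝ (fun Y => fderiv ℝ ψ Y 𝐞[i, a]) X 𝐞[i, a], η X⟫_ℝ := by
  have hg : ∀ (i : Fin N) (a : Fin 3), ContDiff ℝ 1 (fun Y => fderiv ℝ ψ Y 𝐞[i, a]) :=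
    fun i a => contDiff_fderiv_apply_single (n := 1) hψ i a
  have hgc : ∀ (i : Fin N) (a : Fin 3), Continuous (fun Y => fderiv ℝ ψ Y 𝐞[i, a]) :=
    fun i a => (hg i a).continuous
  have hηc : ∀ (i : Fin N) (a : Fin 3), Continuous (fun Y => fderiv ℝ η Y 𝐞[i, a]) :=
    fun i a => (hη.continuous_fderiv one_ne_zero).clm_apply continuous_const
  have hterm : ∀ (i : Fin N) (a : Fin 3),
      ∫ X in cellN N L, ⟪fderiv ℝ ψ X 𝐞[i, a], fderiv ℝ η X 𝐞[i, a]⟫_ℝ =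
        -∫ X in cellN N L, ⟪fderiv ℝ (fun Y => fderiv ℝ ψ Y 𝐞[i, a]) X 𝐞[i, a], η X⟫_ℝ :=
    fun i a => integral_cellN_inner_fderiv_eq_neg hL (hg i a) hη (hψp.fderiv_apply _) hηp i a
  rw [integral_finsetSum _ fun i _ => integrable_finsetSum _ fun a _ =>
    integrableOn_cellN ((hgc i a).inner (𝕜 := ℝ) (hηc i a)) L]
  simp_rw [sum_inner]
  rw [integral_finsetSum _ fun i _ => integrable_finsetSum _ fun a _ =>
    integrableOn_cellN ((((hg i a).continuous_fderiv one_ne_zero).clm_apply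
      continuous_const).inner (𝕜 := ℝ) hη.continuous) L, ← Finset.sum_neg_distrib]
  refine Finset.sum_congr rfl fun i _ => ?_
  rw [integral_finsetSum _ fun a _ => integrableOn_cellN ((hgc i a).inner (𝕜 := ℝ) (hηc i a)) L,
    integral_finsetSum _ fun a _ => integrableOn_cellN ((((hg i a).continuous_fderiv
      one_ne_zero).clm_apply continuous_const).inner (𝕜 := ℝ) hη.continuous) L,
    ← Finset.sum_neg_distrib]
  exact Finset.sum_congr rfl fun a _ => hterm i a

end Calculus

/-! ### From a vanishing `L²` norm on the cell to vanishing everywhere -/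

section ZeroExtension

variable {r : Config N → ℂ}

/-- A continuous function with `∫_{[0,L)^{3N}} |r|² = 0` vanishes on the open box `(0,L)^{3N}`
(Lebesgue measure charges open sets, `lintegral_cellN_pos`). [folklore] -/
theorem eq_zero_of_mem_boxN_of_lintegral_eq_zero (hr : Continuous r)
    (h0 : ∫⁻ X in cellN N L, ((‖r X‖₊ : ℝ≥0∞)) ^ 2 = 0) {X : Config N} (hX : X ∈ boxN N L) :
    r X = 0 := by
  by_contra hne
  exact (lintegral_cellN_pos (L := L) hr (fun i a => hX i a) hne).ne' h0

/-- A continuous function vanishing on the open box `(0,L)^{3N}` vanishes on the closed box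
`[0,L]^{3N}` (continuity along the segment towards the centre, which lies in the open box). [folklore] -/
theorem eq_zero_of_mem_closedBox_of_forall_boxN (hL : 0 < L) (hr : Continuous r) (h : ∀ X ∈ boxN N L, r X = 0)
    {X : Config N} (hX : ∀ (i : Fin N) (k : Fin 3), X i k ∈ Icc 0 L) : r X = 0 := by
  set C : Config N := fun _ => (WithLp.toLp 2 fun _ : Fin 3 => L / 2 : Space) with hC
  set γ : ℝ → Config N := fun t => X + t • (C - X) with hγ
  have hγc : Continuous γ := continuous_const.add (continuous_id.smul continuous_const)
  have hmem : ∀ t ∈ Ioo (0 : ℝ) 1, γ t ∈ boxN N L := by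
    intro t ht i k
    have h1 := hX i k
    simp only [hγ, hC, Pi.add_apply, Pi.smul_apply, Pi.sub_apply, PiLp.add_apply, PiLp.smul_apply,
      PiLp.sub_apply, smul_eq_mul, mem_Ioo, mem_Icc] at h1 ⊢
    constructor <;> nlinarith [ht.1, ht.2, h1.1, h1.2]
  have hEq : EqOn (fun t => r (γ t)) (fun _ => (0 : ℂ)) (Ioo (0 : ℝ) 1) := fun t ht => h _ (hmem t ht)
  have hcl := hEq.closure (hr.comp hγc) continuous_const
  have h0 : (0 : ℝ) ∈ closure (Ioo (0 : ℝ) 1) := by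
    rw [closure_Ioo zero_ne_one]; exact ⟨le_rfl, zero_le_one⟩
  simpa [hγ] using hcl h0

/-- **A continuous `Lℤ³`-periodic function vanishing on the open box vanishes identically** (every
configuration is a lattice translate of a point of `(0,L]^{3N} ⊂ [0,L]^{3N}`). [folklore] -/
theorem IsTorusPeriodic.eq_zero_of_forall_boxN (hL : 0 < L) (hper : IsTorusPeriodic L r)
    (hr : Continuous r) (h : ∀ X ∈ boxN N L, r X = 0) (X : Config N) : r X = 0 := by
  obtain ⟨m, hm⟩ := exists_fromUnitTorusN_toUnitTorusN_eq hL X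
  have h1 : r (fromUnitTorusN L (toUnitTorusN L X)) = 0 := by
    refine eq_zero_of_mem_closedBox_of_forall_boxN hL hr h fun i k => ?_
    have hk := fromUnitTorus_mem hL (fun k' => toUnitTorusN L X (i, k')) k
    rw [fromUnitTorusN_apply]
    exact ⟨hk.1.le, hk.2⟩
  rwa [hm, hper.add_latticeVecN] at h1

/-- **du Bois-Reymond on the torus.** A continuous `Lℤ³`-periodic function with
`∫_{[0,L)^{3N}} |r|² = 0` vanishes identically. [folklore] -/
theorem IsTorusPeriodic.eq_zero_of_lintegral_normSq_eq_zero (hL : 0 < L)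
    (hper : IsTorusPeriodic L r)
    (hr : Continuous r) (h0 : ∫⁻ X in cellN N L, ((‖r X‖₊ : ℝ≥0∞)) ^ 2 = 0) (X : Config N) :
    r X = 0 :=
  hper.eq_zero_of_forall_boxN hL hr (fun _ hY => eq_zero_of_mem_boxN_of_lintegral_eq_zero hr h0 hY) X

end ZeroExtension

end Literature.MathematicalPhysics.QuantumManyBody.BoseGas

end
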